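import Literature.MathematicalPhysics.QuantumFieldTheory.Balaban1983to89.T4HaarSU2LocalDiffeo
import Literature.MathematicalPhysics.QuantumFieldTheory.Balaban1983to89.BlockAveragingEMLHaarAC
import Literature.MathematicalPhysics.QuantumFieldTheory.Balaban1983to89.BlockAveragingExpMeanLogContinuous
import Literature.MathematicalPhysics.QuantumFieldTheory.Balaban1983to89.B12ContinuousTransportInvarianceOn
import Literature.MathematicalPhysics.QuantumFieldTheory.Balaban1983to89.HaarEigenvalueSphereNull
import Literature.MathematicalPhysics.QuantumFieldTheory.Balaban1983to89.T4EMLTangentInjective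
import Mathlib.MeasureTheory.Function.Jacobian
import HarnessLib

/-!
# `FluctuationComparisonRegPrIntLS1aEMLFibreImageNull` — LEMMA A′ ON `SU(2)` (IMAGE FORM) AND THE W-BOUNDARY SET OF ONE (0.4) ENVIRONMENT: a map of `SU(2)` with a
# real-differentiable ambient matrix representative sends Haar-null sets to Haar-null sets; hence the guarded exp-mean-log fibre map `W ↦ E (fibreFamily U c W) · W` of ONE
# environment `U` sends the boundary set `{∀ i, dist1 (fibreFamily U c W i) < 1∕2} ∩ {∃ i, dist1 (fibreFamily U c W i) = r}` (`r ≠ 0`) to a Haar-null set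

Cell `ym3-torus` (HUMAN RULING D-0037: rung R3 = continuum SU(2) Yang–Mills on T³ — a RUNG: NOT d = 4, NOT infinite volume, NOT a mass gap, NOT Clay), WIDTH COPY «width 20»
of ym3-torus-p1, seat `ym3-torus-px20` gen 22; `--kind proof --supports stmt-QuantumFields-20520 --as helper` (count-neutral).  THEOREMS ONLY (0 `def`, 0 `sorry`, 0 `instance`,
0 `notation`, default heartbeats, `autoImplicit false`).  FILE 1 of 2 of (F4-b) of px17 g21's road to S1aᴴ (c) at the anchor heights (interface 13:14:32Z); FILE 2 =
`…S1aEMLBoundarySliceNull` (the joint graph, endpoint-gauge transitivity, the per-datum statement for EVERY coarse value).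

CONTENT (all [folklore] measure theory ∕ calculus over Mathlib + tree modules; nothing of Bałaban's analysis).
* §1 ★ LEMMA A′ ON `SU(2)`, IMAGE FORM: `haar_null_of_subset_image_of_differentiableAt` ∕ `haarData_null_of_subset_image_of_differentiableAt` — `N ⊆ SU(2)` Haar-null measurable,
  `K : SU(2) → SU(2)` with an ambient `Kmat : M₂(ℂ) → M₂(ℂ)` REAL-differentiable at `↑W` and `= ↑(K W)` there for `W ∈ N` ⟹ every measurable `A ⊆ K '' N` is Haar-null.  Cone lift
  `q ↦ ‖q‖ • topRow (Kmat (quatMatrix (q∕‖q‖)))` on `ℍ` (local Borel instances of `Tao2016`), Mathlib `addHaar_image_eq_zero_of_differentiableOn_of_addHaar_eq_zero`, and the cone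
  criterion lit ✓`T4HaarSU2Translate.volume_preimage_quatToSU2_null` ∕ `haar_null_of_volume_preimage_null`; the image-form twin of ✓`T4HaarSU2LocalDiffeo`'s Lemma A — NO tangent
  injectivity needed.
* §2 ONE ENVIRONMENT `U` at a coarse bond `c` (lit ✓`BlockAveragingEMLHaarAC.fibreFamily`: `1` at central indices, `V_i · W⁻¹` off-central): `continuous_fibreFamily_right` ∕ `_uncurry`;
  `haar_setOf_dist1_mul_inv_eq_eq_zero` (translated `dist1`-spheres `{dist1 (h·W⁻¹) = r}` are Haar-null: two-sided invariance + lit ✓`haar_setOf_dist1_eq_eq_zero_specialUnitaryGroup`);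
  `measurableSet_boundarySet`, ★`haar_boundarySet_eq_zero`; ★`differentiableAt_emlFibreMat` (`M ↦ eml(1 at central i, V_i·M* off-central)·M` is real-differentiable wherever
  `‖V_i M* − 1‖ < 1`: lit ✓`ExpMeanLog.analyticAt_eml` restricted to `ℝ`, ✓`T4EMLTangentInjective.starR`); ★★`haar_null_of_subset_image_boundarySet` — for ANY extension `E` of
  the printed `exp[mean log]` off the `1∕2`-guard (`hE : ∀ W, (∀ i, ‖↑(W i) − 1‖ < 1∕2) → ↑(E W) = eml (↑W)`), every measurable subset of
  `(W ↦ E (fibreFamily U c W) · W) '' N_U(r)` is Haar-null.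

HONEST FRAMING.  [folklore] measure theory; `hE` is a HYPOTHESIS on the extension `E`; nothing of Bałaban's renormalisation-group analysis is asserted or proved; S1aᴴ (c) is NOT
closed here; the five registered stubs of `Lines/semiclassical_s2beta.lean` (3732b7df, untouched), crux 20520 ∕ 19936 ∕ 19200 and `YM3TorusSU2` are NOT proved; registry untouched;
rung R3 = SU(2) YM₃ on T³ at fixed lattice data — NOT d = 4, NOT infinite volume, NOT a mass gap, NOT Clay; the Yang–Mills mass gap is NOT proved by any of this.
References: [Balaban1987RG1] T. Bałaban, CMP **109** (1987) 249–301, (0.4)–(0.6) p. 253; [Balaban1985Averaging] CMP **98** (1985) 17–51, (19) p. 21.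
-/

set_option autoImplicit false

noncomputable section

open MeasureTheory Set Function Filter Topology
open scoped ENNReal Quaternion Matrix.Norms.L2Operator

namespace Summit.QuantumFields.YangMills.Theorems.FluctuationComparisonRegPrIntLS1aEMLFibreImageNull

/-! ## §1 [folklore] LEMMA A′ on `SU(2)`: a map with a differentiable ambient representative sends Haar-null sets to Haar-null sets -/

section LemmaAPrime

open Literature.MathematicalPhysics.QuantumFieldTheory (haarProbability)
open Literature.MathematicalPhysics.QuantumLattice (quatMatrix su2Quat norm_su2Quat su2Quat_ne_zero quatToSU2 coe_quatToSU2
  quatToSU2_su2Quat quatMatrix_su2Quat measurable_quatToSU2 quatToSU2_smul)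
open Literature.MathematicalPhysics.QuantumFieldTheory.Balaban1983to89.T4HaarSU2Translate (su2Quat_quatToSU2
  haar_null_of_volume_preimage_null volume_preimage_quatToSU2_null haarData_haar_eq)
open Literature.MathematicalPhysics.QuantumFieldTheory.Balaban1983to89.T4HaarSU2LocalDiffeo (topRowQuat topRowQuat_coe quatMatrixCLM
  quatMatrixCLM_apply)

/-- ★ **LEMMA A′ ON `SU(2)` (IMAGE FORM).**  Let `N ⊆ SU(2)` be a Haar-null measurable set, `K : SU(2) → SU(2)` any map, and `Kmat : M₂(ℂ) → M₂(ℂ)` an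
ambient map, REAL-differentiable at `↑W` and equal to `↑(K W)` there, for every `W ∈ N`.  Then every measurable `A ⊆ K '' N` is Haar-null.  (Cone lift
`q ↦ ‖q‖ • topRow (Kmat (quatMatrix (q∕‖q‖)))` on `ℍ`, Mathlib's «a differentiable map sends Lebesgue-null sets to null sets», and the cone criterion
`Haar N = 0 ↔ vol (quatToSU2⁻¹ N) = 0`; no injectivity of any differential is needed.) [folklore] -/
theorem haar_null_of_subset_image_of_differentiableAt {N : Set (Matrix.specialUnitaryGroup (Fin 2) ℂ)} (hNm : MeasurableSet N)
    (hN : haarProbability (Matrix.specialUnitaryGroup (Fin 2) ℂ) N = 0)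
    {K : Matrix.specialUnitaryGroup (Fin 2) ℂ → Matrix.specialUnitaryGroup (Fin 2) ℂ} {Kmat : Matrix (Fin 2) (Fin 2) ℂ → Matrix (Fin 2) (Fin 2) ℂ}
    (hd : ∀ W ∈ N, DifferentiableAt ℝ Kmat (W : Matrix (Fin 2) (Fin 2) ℂ))
    (hKmat : ∀ W ∈ N, Kmat (W : Matrix (Fin 2) (Fin 2) ℂ) = ((K W : Matrix.specialUnitaryGroup (Fin 2) ℂ) : Matrix (Fin 2) (Fin 2) ℂ))
    {A : Set (Matrix.specialUnitaryGroup (Fin 2) ℂ)} (hA : MeasurableSet A) (hAK : A ⊆ K '' N) :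
    haarProbability (Matrix.specialUnitaryGroup (Fin 2) ℂ) A = 0 := by
  letI : MeasurableSpace ℍ := Literature.Analysis.FluidPDE.Tao2016.quatMeasurableSpace
  haveI : BorelSpace ℍ := Literature.Analysis.FluidPDE.Tao2016.quatBorelSpace
  haveI := Literature.MathematicalPhysics.QuantumLattice.secondCountableTopology_su2
  -- the cone over `N`, without the origin
  set T : Set ℍ := quatToSU2 ⁻¹' N ∩ {q | q ≠ 0} with hT
  have hT0 : (volume : Measure ℍ) T = 0 := measure_mono_null inter_subset_left (volume_preimage_quatToSU2_null hNm hN)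
  -- the cone lift of `K`
  set f : ℍ → ℍ := fun q => ‖q‖ • topRowQuat (Kmat (quatMatrix (‖q‖⁻¹ • q))) with hf
  have hfd : DifferentiableOn ℝ f T := by
    intro q hq
    have hq0 : q ≠ 0 := hq.2
    have hqN : quatToSU2 q ∈ N := hq.1
    have hnorm : DifferentiableAt ℝ (fun q : ℍ => ‖q‖) q := DifferentiableAt.norm ℝ differentiableAt_id hq0
    have hrad : DifferentiableAt ℝ (fun q : ℍ => ‖q‖⁻¹ • q) q := (hnorm.inv (norm_ne_zero_iff.2 hq0)).smul differentiableAt_id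
    have hmat : DifferentiableAt ℝ (fun q : ℍ => quatMatrix (‖q‖⁻¹ • q)) q := by
      have h1 : DifferentiableAt ℝ ((quatMatrixCLM : ℍ → Matrix (Fin 2) (Fin 2) ℂ) ∘ fun q : ℍ => ‖q‖⁻¹ • q) q :=
        DifferentiableAt.comp q quatMatrixCLM.differentiableAt hrad
      simpa only [Function.comp_def, quatMatrixCLM_apply] using h1
    have hK' : DifferentiableAt ℝ Kmat (quatMatrix (‖q‖⁻¹ • q)) := by
      rw [← coe_quatToSU2 hq0]; exact hd _ hqN
    have hcomp : DifferentiableAt ℝ (Kmat ∘ fun q : ℍ => quatMatrix (‖q‖⁻¹ • q)) q := DifferentiableAt.comp q hK' hmat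
    have htop : DifferentiableAt ℝ ((topRowQuat : Matrix (Fin 2) (Fin 2) ℂ → ℍ) ∘ (Kmat ∘ fun q : ℍ => quatMatrix (‖q‖⁻¹ • q))) q :=
      DifferentiableAt.comp q topRowQuat.differentiableAt hcomp
    have hfin : DifferentiableAt ℝ (fun q : ℍ => ‖q‖ • topRowQuat (Kmat (quatMatrix (‖q‖⁻¹ • q)))) q :=
      (hnorm.smul htop).congr_of_eventuallyEq (Filter.Eventually.of_forall fun y => rfl)
    exact hfin.differentiableWithinAt
  have hfT : (volume : Measure ℍ) (f '' T) = 0 := addHaar_image_eq_zero_of_differentiableOn_of_addHaar_eq_zero volume hfd hT0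
  -- the cone over `A` lies in `f(T) ∪ {0}`
  have hsub : quatToSU2 ⁻¹' A ⊆ f '' T ∪ {0} := by
    intro q hq
    by_cases hq0 : q = 0
    · exact Or.inr hq0
    refine Or.inl ?_
    obtain ⟨W, hWN, hKW⟩ := hAK hq
    have hn : 0 < ‖q‖ := norm_pos_iff.2 hq0
    refine ⟨‖q‖ • su2Quat W, ⟨?_, smul_ne_zero hn.ne' (su2Quat_ne_zero W)⟩, ?_⟩
    · show quatToSU2 (‖q‖ • su2Quat W) ∈ N
      rw [quatToSU2_smul hn, quatToSU2_su2Quat]; exact hWN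
    · have hns : ‖‖q‖ • su2Quat W‖ = ‖q‖ := by rw [norm_smul, norm_norm, norm_su2Quat, mul_one]
      simp only [hf, hns]
      rw [smul_smul, inv_mul_cancel₀ hn.ne', one_smul, quatMatrix_su2Quat, hKmat W hWN, topRowQuat_coe, hKW,
        su2Quat_quatToSU2 hq0, smul_smul, mul_inv_cancel₀ hn.ne', one_smul]
  have hvol : (volume : Measure ℍ) (quatToSU2 ⁻¹' A) = 0 :=
    measure_mono_null hsub (measure_union_null hfT (measure_singleton _))
  exact haar_null_of_volume_preimage_null hA hvol

/-- The same for the cell's `HaarData.haar` on `SU(2)` (`= haarProbability`, `rfl`). [folklore] -/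
theorem haarData_null_of_subset_image_of_differentiableAt {N : Set (Matrix.specialUnitaryGroup (Fin 2) ℂ)} (hNm : MeasurableSet N)
    (hN : (Literature.MathematicalPhysics.QuantumFieldTheory.Balaban1983to89.HaarData.haar :
      Measure (Matrix.specialUnitaryGroup (Fin 2) ℂ)) N = 0)
    {K : Matrix.specialUnitaryGroup (Fin 2) ℂ → Matrix.specialUnitaryGroup (Fin 2) ℂ} {Kmat : Matrix (Fin 2) (Fin 2) ℂ → Matrix (Fin 2) (Fin 2) ℂ}
    (hd : ∀ W ∈ N, DifferentiableAt ℝ Kmat (W : Matrix (Fin 2) (Fin 2) ℂ))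
    (hKmat : ∀ W ∈ N, Kmat (W : Matrix (Fin 2) (Fin 2) ℂ) = ((K W : Matrix.specialUnitaryGroup (Fin 2) ℂ) : Matrix (Fin 2) (Fin 2) ℂ))
    {A : Set (Matrix.specialUnitaryGroup (Fin 2) ℂ)} (hA : MeasurableSet A) (hAK : A ⊆ K '' N) :
    (Literature.MathematicalPhysics.QuantumFieldTheory.Balaban1983to89.HaarData.haar : Measure (Matrix.specialUnitaryGroup (Fin 2) ℂ)) A = 0 := by
  rw [haarData_haar_eq] at hN ⊢
  exact haar_null_of_subset_image_of_differentiableAt hNm hN hd hKmat hA hAK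

end LemmaAPrime

/-! ## §2 The EML-branch boundary set of ONE environment `U` is sent to a Haar-null set by the guarded fibre map -/

section Slice

open Literature.MathematicalPhysics.QuantumFieldTheory.Balaban1983to89
open T4Continuum BlockAveraging BlockAveragingHaarAC BlockAveragingEMLHaarAC
open ExpMeanLog (eml analyticAt_eml)
open HaarEigenvalueSphereNull (haar_setOf_dist1_eq_eq_zero_specialUnitaryGroup)

variable {P : Params} {j : ℕ}

/-- `W ↦ fibreFamily U c W i` is continuous (constant `1` at a central index, `V_i · W⁻¹` at an off-central one). [folklore] -/
theorem continuous_fibreFamily_right (U : GaugeField P j (Matrix.specialUnitaryGroup (Fin 2) ℂ)) (c : PBond P (j + 1)) (i : Idx P) :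
    Continuous fun W : Matrix.specialUnitaryGroup (Fin 2) ℂ => fibreFamily U c W i := by
  by_cases h : IsCentral c i
  · simp only [fibreFamily_of_isCentral U c _ i h]; exact continuous_const
  · simp only [fibreFamily_of_not_isCentral U c _ i h]; exact continuous_const.mul continuous_inv

/-- `(U, W) ↦ fibreFamily U c W i` is jointly continuous. [folklore] -/
theorem continuous_fibreFamily_uncurry (c : PBond P (j + 1)) (i : Idx P) :
    Continuous fun x : GaugeField P j (Matrix.specialUnitaryGroup (Fin 2) ℂ) × Matrix.specialUnitaryGroup (Fin 2) ℂ => fibreFamily x.1 c x.2 i := by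
  by_cases h : IsCentral c i
  · simp only [fibreFamily_of_isCentral _ c _ i h]; exact continuous_const
  · simp only [fibreFamily_of_not_isCentral _ c _ i h]
    exact ((BlockAveraging.continuous_holAt _).comp continuous_fst).mul (continuous_snd.inv)

/-- A translated `dist1`-sphere `{W | dist1 (h · W⁻¹) = r}`, `r ≠ 0`, is Haar-null in `SU(2)` (two-sided invariance + lit
✓`haar_setOf_dist1_eq_eq_zero_specialUnitaryGroup`). [folklore] -/
theorem haar_setOf_dist1_mul_inv_eq_eq_zero (h : Matrix.specialUnitaryGroup (Fin 2) ℂ) {r : ℝ} (hr : r ≠ 0) :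
    (HaarData.haar : Measure (Matrix.specialUnitaryGroup (Fin 2) ℂ)) {W | dist1 (h * W⁻¹) = r} = 0 := by
  have hS : MeasurableSet {g : Matrix.specialUnitaryGroup (Fin 2) ℂ | dist1 g = r} :=
    RegularGaugeGroup.measurable_dist1 (measurableSet_singleton r)
  have hinv : MeasurePreserving (fun W : Matrix.specialUnitaryGroup (Fin 2) ℂ => W⁻¹)
      (HaarData.haar : Measure (Matrix.specialUnitaryGroup (Fin 2) ℂ)) HaarData.haar := ⟨measurable_inv, HaarData.map_inv⟩
  have hmul : MeasurePreserving (fun W : Matrix.specialUnitaryGroup (Fin 2) ℂ => h * W)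
      (HaarData.haar : Measure (Matrix.specialUnitaryGroup (Fin 2) ℂ)) HaarData.haar := ⟨measurable_const_mul h, HaarData.map_mul_left h⟩
  have hcomp := hmul.comp hinv
  have hpre := hcomp.measure_preimage hS.nullMeasurableSet
  rw [haar_setOf_dist1_eq_eq_zero_specialUnitaryGroup (n := Fin 2) hr] at hpre
  exact hpre

/-- The EML-branch boundary set `N_U(r) = {W | ∀ i, dist1 (fibreFamily U c W i) < 1∕2, ∃ i, dist1 (fibreFamily U c W i) = r}` of one environment is MEASURABLE.
[folklore] -/
theorem measurableSet_boundarySet (U : GaugeField P j (Matrix.specialUnitaryGroup (Fin 2) ℂ)) (c : PBond P (j + 1)) (r : ℝ) :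
    MeasurableSet {W : Matrix.specialUnitaryGroup (Fin 2) ℂ |
      (∀ i, dist1 (fibreFamily U c W i) < 1 / 2) ∧ ∃ i, dist1 (fibreFamily U c W i) = r} := by
  have hc : ∀ i, Continuous fun W : Matrix.specialUnitaryGroup (Fin 2) ℂ => dist1 (fibreFamily U c W i) := fun i =>
    B12ContinuousTransportInvarianceOn.continuous_dist1_SU.comp (continuous_fibreFamily_right U c i)
  have h1 : MeasurableSet {W : Matrix.specialUnitaryGroup (Fin 2) ℂ | ∀ i, dist1 (fibreFamily U c W i) < 1 / 2} := by
    rw [Set.setOf_forall]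
    exact MeasurableSet.iInter fun i => (isOpen_lt (hc i) continuous_const).measurableSet
  have h2 : MeasurableSet {W : Matrix.specialUnitaryGroup (Fin 2) ℂ | ∃ i, dist1 (fibreFamily U c W i) = r} := by
    rw [Set.setOf_exists]
    exact MeasurableSet.iUnion fun i => (isClosed_eq (hc i) continuous_const).measurableSet
  rw [Set.setOf_and]; exact h1.inter h2

/-- … and HAAR-NULL for `r ≠ 0`: it lies on the finitely many translated spheres `{dist1 (V_i · W⁻¹) = r}` of the OFF-CENTRAL indices (a central loop variable is
`1`, `dist1 1 = 0 ≠ r`). [cite: Balaban1987RG1, (0.4) p.253] -/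
theorem haar_boundarySet_eq_zero (U : GaugeField P j (Matrix.specialUnitaryGroup (Fin 2) ℂ)) (c : PBond P (j + 1)) {r : ℝ} (hr : r ≠ 0) :
    (HaarData.haar : Measure (Matrix.specialUnitaryGroup (Fin 2) ℂ))
      {W | (∀ i, dist1 (fibreFamily U c W i) < 1 / 2) ∧ ∃ i, dist1 (fibreFamily U c W i) = r} = 0 := by
  have hsub : {W : Matrix.specialUnitaryGroup (Fin 2) ℂ | (∀ i, dist1 (fibreFamily U c W i) < 1 / 2) ∧ ∃ i, dist1 (fibreFamily U c W i) = r} ⊆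
      ⋃ i, {W | dist1 (fibreFamily U c W i) = r} := by
    rintro W ⟨-, i, hi⟩; exact Set.mem_iUnion.2 ⟨i, hi⟩
  refine measure_mono_null hsub ((measure_iUnion_null_iff).2 fun i => ?_)
  by_cases h : IsCentral c i
  · have he : {W : Matrix.specialUnitaryGroup (Fin 2) ℂ | dist1 (fibreFamily U c W i) = r} = ∅ := by
      ext W
      simp only [Set.mem_setOf_eq, Set.mem_empty_iff_false, iff_false, fibreFamily_of_isCentral U c W i h, GaugeGroup.dist1_one]
      exact fun h' => hr h'.symm
    rw [he, measure_empty]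
  · have he : {W : Matrix.specialUnitaryGroup (Fin 2) ℂ | dist1 (fibreFamily U c W i) = r} = {W | dist1 (openHol U c i * W⁻¹) = r} := by
      ext W; rw [Set.mem_setOf_eq, Set.mem_setOf_eq, fibreFamily_of_not_isCentral U c W i h]
    rw [he]; exact haar_setOf_dist1_mul_inv_eq_eq_zero _ hr

/-- The ambient matrix map of the guarded fibre map of one environment: `M ↦ eml(1 at central i, V_i · M* off-central) · M`. It is REAL-DIFFERENTIABLE at every matrix `M`
with `‖V_i M* − 1‖ < 1` at all off-central `i` (the ℂ-analytic `exp[mean log]` of the tree, lit ✓`ExpMeanLog.analyticAt_eml`, composed with the real-linear `M ↦ M*`).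
[folklore] -/
theorem differentiableAt_emlFibreMat (U : GaugeField P j (Matrix.specialUnitaryGroup (Fin 2) ℂ)) (c : PBond P (j + 1)) {M : Matrix (Fin 2) (Fin 2) ℂ}
    (hM : ∀ i, ¬ IsCentral c i → ‖((openHol U c i : Matrix.specialUnitaryGroup (Fin 2) ℂ) : Matrix (Fin 2) (Fin 2) ℂ) * star M - 1‖ < 1) :
    DifferentiableAt ℝ (fun M : Matrix (Fin 2) (Fin 2) ℂ =>
      eml (fun i : Idx P => if IsCentral c i then (1 : Matrix (Fin 2) (Fin 2) ℂ)
        else ((openHol U c i : Matrix.specialUnitaryGroup (Fin 2) ℂ) : Matrix (Fin 2) (Fin 2) ℂ) * star M) * M) M := by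
  classical
  -- the inner family is real-differentiable (affine in `M*`)
  set G : Matrix (Fin 2) (Fin 2) ℂ → (Idx P → Matrix (Fin 2) (Fin 2) ℂ) := fun M i =>
    if IsCentral c i then (1 : Matrix (Fin 2) (Fin 2) ℂ) else ((openHol U c i : Matrix.specialUnitaryGroup (Fin 2) ℂ) : Matrix (Fin 2) (Fin 2) ℂ) * star M with hG
  have hstar : DifferentiableAt ℝ (fun M : Matrix (Fin 2) (Fin 2) ℂ => star M) M :=
    ((T4EMLTangentInjective.starR (m := Fin 2)).differentiableAt (x := M)).congr_of_eventuallyEq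
      (Filter.Eventually.of_forall fun M' => (T4EMLTangentInjective.starR_apply M').symm)
  have hGd : DifferentiableAt ℝ G M := by
    refine differentiableAt_pi.2 fun i => ?_
    by_cases h : IsCentral c i
    · simp only [hG, h, if_true]; exact differentiableAt_const _
    · simp only [hG, h, if_false]; exact (differentiableAt_const _).mul hstar
  -- `eml` is analytic at `G M` (all members within `1` of the identity)
  have hGM : ∀ i, ‖G M i - 1‖ < 1 := by
    intro i
    by_cases h : IsCentral c i
    · simp only [hG, h, if_true, sub_self, norm_zero]; exact zero_lt_one
    · simp only [hG, h, if_false]; exact hM i h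
  have heml : DifferentiableAt ℝ (eml : (Idx P → Matrix (Fin 2) (Fin 2) ℂ) → Matrix (Fin 2) (Fin 2) ℂ) (G M) :=
    ((analyticAt_eml (𝔸 := Matrix (Fin 2) (Fin 2) ℂ) hGM).differentiableAt).restrictScalars ℝ
  have hcomp : DifferentiableAt ℝ (fun M => eml (G M)) M := DifferentiableAt.comp M heml hGd
  exact hcomp.mul differentiableAt_id

/-- ★★ **THE `W`-SLICE OF ONE ENVIRONMENT IS HAAR-NULL.**  For every environment `U`, coarse bond `c`, radius `r ≠ 0` and ANY extension `E` of the printed `exp[mean log]` off the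
`1∕2`-guard: every measurable subset of the image of the boundary set `N_U(r)` under the guarded fibre map `W ↦ E (fibreFamily U c W) · W` is Haar-null (Lemma A′ of §1 at the
null set `N_U(r)` and the differentiable ambient map of the previous theorem). [cite: Balaban1987RG1, (0.4) p.253] -/
theorem haar_null_of_subset_image_boundarySet (U : GaugeField P j (Matrix.specialUnitaryGroup (Fin 2) ℂ)) (c : PBond P (j + 1)) {r : ℝ} (hr : r ≠ 0)
    (E : (Idx P → Matrix.specialUnitaryGroup (Fin 2) ℂ) → Matrix.specialUnitaryGroup (Fin 2) ℂ)
    (hE : ∀ W : Idx P → Matrix.specialUnitaryGroup (Fin 2) ℂ, (∀ i, ‖((W i : Matrix.specialUnitaryGroup (Fin 2) ℂ) : Matrix (Fin 2) (Fin 2) ℂ) - 1‖ < 1 / 2) →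
      ((E W : Matrix.specialUnitaryGroup (Fin 2) ℂ) : Matrix (Fin 2) (Fin 2) ℂ) = eml (fun i => ((W i : Matrix.specialUnitaryGroup (Fin 2) ℂ) : Matrix (Fin 2) (Fin 2) ℂ)))
    {A : Set (Matrix.specialUnitaryGroup (Fin 2) ℂ)} (hA : MeasurableSet A)
    (hAK : A ⊆ (fun W => E (fibreFamily U c W) * W) '' {W | (∀ i, dist1 (fibreFamily U c W i) < 1 / 2) ∧ ∃ i, dist1 (fibreFamily U c W i) = r}) :
    (HaarData.haar : Measure (Matrix.specialUnitaryGroup (Fin 2) ℂ)) A = 0 := by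
  classical
  refine haarData_null_of_subset_image_of_differentiableAt (measurableSet_boundarySet U c r) (haar_boundarySet_eq_zero U c hr)
    (K := fun W => E (fibreFamily U c W) * W)
    (Kmat := fun M : Matrix (Fin 2) (Fin 2) ℂ => eml (fun i : Idx P => if IsCentral c i then (1 : Matrix (Fin 2) (Fin 2) ℂ)
      else ((openHol U c i : Matrix.specialUnitaryGroup (Fin 2) ℂ) : Matrix (Fin 2) (Fin 2) ℂ) * star M) * M)
    (fun W hW => differentiableAt_emlFibreMat U c fun i hi => ?_) (fun W hW => ?_) hA hAK
  · -- guard ⇒ `‖V_i W* − 1‖ < 1∕2 < 1`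
    have h := hW.1 i
    rw [dist1_fibreFamily_of_not_isCentral U c W i hi] at h
    exact h.trans (by norm_num)
  · -- on the guard the two maps agree
    have hfam : (fun i : Idx P => if IsCentral c i then (1 : Matrix (Fin 2) (Fin 2) ℂ)
        else ((openHol U c i : Matrix.specialUnitaryGroup (Fin 2) ℂ) : Matrix (Fin 2) (Fin 2) ℂ) * star (W : Matrix (Fin 2) (Fin 2) ℂ)) =
        fun i => ((fibreFamily U c W i : Matrix.specialUnitaryGroup (Fin 2) ℂ) : Matrix (Fin 2) (Fin 2) ℂ) := by
      funext i
      by_cases h : IsCentral c i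
      · rw [if_pos h, fibreFamily_of_isCentral U c W i h]; rfl
      · rw [if_neg h, coe_fibreFamily_of_not_isCentral U c W i h]
    have hguard : ∀ i, ‖((fibreFamily U c W i : Matrix.specialUnitaryGroup (Fin 2) ℂ) : Matrix (Fin 2) (Fin 2) ℂ) - 1‖ < 1 / 2 := fun i => hW.1 i
    show eml _ * (W : Matrix (Fin 2) (Fin 2) ℂ) = ((E (fibreFamily U c W) * W : Matrix.specialUnitaryGroup (Fin 2) ℂ) : Matrix (Fin 2) (Fin 2) ℂ)
    rw [hfam, Submonoid.coe_mul, hE _ hguard]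

end Slice

end Summit.QuantumFields.YangMills.Theorems.FluctuationComparisonRegPrIntLS1aEMLFibreImageNull

end
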